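import Summits.FinalStateConjecture.FinalStateConjecture.Theorems.PhotonSphereChannelsTameEternalLimitDefs
import Summits.FinalStateConjecture.FinalStateConjecture.Theorems.PhotonSphereChannelsChannelsResolveTameDevelopmentsRTrappedSetMinkowskiLimit
import Literature.Geometry.Lorentzian.KerrSchildCoord
import Literature.Geometry.Lorentzian.NonRadiatingBurnettLimit
import HarnessLib

/-!
# Crux `ChannelsResolveTameDevelopmentsR` (stmt-FinalStateConjecture-14075), line
# `trapped-set-observability-analyticity` — stub `stub_harmonicPresentation` (S3):
# what a presentation of a tame eternal limit must cover, the presentation cylinder, and the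
# identity presentation of Minkowski space

Audit lemmas for stub S3 (`stub_harmonicPresentation`: every red-shifted `TameEternalLimit` is
PRESENTED — one injective local diffeomorphism `Ξ : cyl a r₀ → Z` of the presentation cylinder
`cyl a r₀ = {x ∈ E4 | r₀ < r(a, x)}` whose image covers `closure ⟨⟨Φ⟩⟩` and in which `Ξ^* g` is a
dark eternal harmonic exterior), over the landed vocabulary `Theorems.TrappedSet`
(`PhotonSphereChannelsTameEternalLimitDefs.lean`: `TameEternalLimit`, `.doc`, `.horizon`) and with
the line's `cyl a r₀` / `presentationBackground a r₀ = ⟨cyl a r₀, 0, x⁰, r(a,·)⟩` written UNFOLDED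
(`{x : E4 | r₀ < Kerr.radius a x}`; their `Defs` part 2 is not in the tree yet), so that every
statement applies to them by `rfl`.

* §1 CAUSAL ANATOMY of a `TameEternalLimit` (what the clause `covers : closure E.doc ⊆ range Ξ`
  of `IsPresentedBy` asks).  The structure clause `Z ⊆ I⁺(range Φ)` makes
  `⟨⟨Φ⟩⟩ = I⁻(range Φ)` (`doc_eq_chronologicalPast`), the event horizon
  `𝓗 = ∂I⁻(range Φ) ∩ I⁺(range Φ)` the full topological frontier of the d.o.c.
  (`horizon_eq_frontier_doc`), hence `closure ⟨⟨Φ⟩⟩ = ⟨⟨Φ⟩⟩ ∪ 𝓗` EXACTLY (`closure_doc_eq_union`: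
  a presentation must cover the d.o.c. AND every horizon component, nothing else), and — `Z` being
  connected and `⟨⟨Φ⟩⟩ ∋` (closure) the base point — THE HORIZON IS EMPTY IFF THE D.O.C. IS ALL OF
  `Z` (`horizon_eq_empty_iff`).  Consequence (`surjective_of_horizon_eq_empty`): a presentation of a
  HORIZONLESS limit is surjective, i.e. a bijective local diffeomorphism `cyl a r₀ ≅ Z`; with
  `r₀ < 0` (`cyl = E4`, §2) stub S3 restricted to horizonless limits therefore contains the
  topological statement `Z ≅ ℝ⁴` (registered sub-goals `stub_closureDocEqDocUnionHorizon`,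
  `stub_presentationSurjectiveOfHorizonless`).
* §2 THE PRESENTATION CYLINDER `{x | r₀ < r(a, x)}`: open; invariant under the time translations
  `x ↦ x + s ∂₀` (the Kerr–Schild radius ignores `x⁰`, `Kerr.radius_add_time_smul_basisVector`);
  antitone in `r₀`; equal to `Kerr.region a r₀` for `0 ≤ r₀`; equal to ALL of `E4` iff `r₀ < 0`
  (the oblate radius vanishes at the origin) — registered sub-goal `stub_cylBasicAPI`.
* §3 THE IDENTITY PRESENTATION OF MINKOWSKI SPACE (non-vacuity of S3's conclusion on the one
  `TameEternalLimit` in the tree, the exact Minkowski limit of `stub_tameEternalLimitNonempty`,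
  MODULO the neighbour stub S4's lemma that flat space is a presented dark exterior for `r₀ < 0`):
  for `r₀ < 0` the inclusion `Ξ = ι : cyl a r₀ = E4 → (ℝ⁴, η)` is an injective local
  diffeomorphism with `range ι = univ` (so `covers` holds for ANY d.o.c.), its presented components
  `deviationExtend ⟨cyl, 0, x⁰, r⟩ ι` are the CONSTANT `η` (no junk zero-extension anywhere,
  `deviationExtend_cyl_subtypeVal_minkowski`), and the presented future normal
  `ι_*(−♯_η dx⁰) = ∂₀` is the Minkowski time orientation, hence future-directed
  (`isFutureDirected_identityPresentation`) — the four `G`-independent fields of `IsPresentedBy`;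
  registered sub-goal `stub_minkowskiIdentityPresentation`.
-/

set_option linter.dupNamespace false

noncomputable section

namespace Summit.FinalStateConjecture.FinalStateConjecture.Theorems.TrappedSet

open Literature.Geometry.Lorentzian
open scoped Manifold ContDiff Topology
open Filter Set Function TopologicalSpace

/-! ## §1 Causal anatomy of a tame eternal limit -/

namespace TameEternalLimit

variable (E : TameEternalLimit)

/-- `I⁺(range Φ) = Z`: the whole limit lies to the chronological future of its far end (the
structure clause `subset_chronologicalFuture`, "no white-hole ends"). [folklore] -/
theorem chronologicalFuture_far_eq_univ :
    E.Z.metric.chronologicalFuture E.Z.timeOrientation (Set.range E.Φ) = univ :=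
  Set.eq_univ_of_univ_subset E.subset_chronologicalFuture

/-- Hence the d.o.c. `⟨⟨Φ⟩⟩ = I⁺(range Φ) ∩ I⁻(range Φ)` of the far end is just `I⁻(range Φ)`.
[cite: Wald1984, §12.1] -/
theorem doc_eq_chronologicalPast :
    E.doc = E.Z.metric.chronologicalPast E.Z.timeOrientation (Set.range E.Φ) := by
  change E.Z.metric.chronologicalFuture E.Z.timeOrientation (Set.range E.Φ) ∩ _ = _
  rw [chronologicalFuture_far_eq_univ, univ_inter]

/-- And the future event horizon `𝓗 = ∂I⁻(range Φ) ∩ I⁺(range Φ)` is the full topological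
frontier of the d.o.c. in `Z`. [cite: HawkingEllis1973, §9.2] -/
theorem horizon_eq_frontier_doc : E.horizon = frontier E.doc := by
  change frontier (E.Z.metric.chronologicalPast E.Z.timeOrientation (Set.range E.Φ)) ∩
      E.Z.metric.chronologicalFuture E.Z.timeOrientation (Set.range E.Φ) = _
  rw [chronologicalFuture_far_eq_univ, inter_univ, doc_eq_chronologicalPast]

/-- **What a presentation must cover**: `closure ⟨⟨Φ⟩⟩ = ⟨⟨Φ⟩⟩ ∪ 𝓗` — the d.o.c. together with
EVERY component of the event horizon, and nothing else. [folklore] -/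
theorem closure_doc_eq_union : closure E.doc = E.doc ∪ E.horizon := by
  rw [horizon_eq_frontier_doc, closure_eq_self_union_frontier]

/-- The d.o.c. of a tame eternal limit is nonempty (the base point lies in its closure).
[folklore] -/
theorem doc_nonempty : E.doc.Nonempty := by
  by_contra h
  have hz : E.z ∈ closure E.doc := E.basepoint_mem
  rw [Set.not_nonempty_iff_eq_empty.mp h, closure_empty] at hz
  exact hz

/-- **The horizon is empty iff the d.o.c. is all of `Z`** (`Z` is connected and `𝓗 = ∂⟨⟨Φ⟩⟩`: an
empty frontier makes the nonempty d.o.c. clopen). [folklore] -/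
theorem horizon_eq_empty_iff : E.horizon = ∅ ↔ E.doc = univ := by
  rw [horizon_eq_frontier_doc, ← isClopen_iff_frontier_eq_empty, isClopen_iff]
  exact ⟨fun h ↦ h.resolve_left E.doc_nonempty.ne_empty, Or.inr⟩

/-- For a horizonless limit the set to be covered by a presentation is all of `Z`. [folklore] -/
theorem closure_doc_eq_univ (h : E.horizon = ∅) : closure E.doc = univ := by
  rw [E.horizon_eq_empty_iff.mp h, closure_univ]

/-- **A presentation of a horizonless limit is onto**: if `𝓗 = ∅`, any map whose range covers
`closure ⟨⟨Φ⟩⟩` is surjective — so an injective local diffeomorphism `Ξ : cyl a r₀ → Z` with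
`closure ⟨⟨Φ⟩⟩ ⊆ range Ξ` (`IsPresentedBy`) is a bijective local diffeomorphism `cyl a r₀ ≅ Z`:
stub S3 on horizonless limits contains the topological assertion `Z ≅ cyl a r₀` (`≅ ℝ⁴` for
`r₀ < 0`). [folklore] -/
theorem surjective_of_horizon_eq_empty (h : E.horizon = ∅) {α : Type*} {Ξ : α → E.Z.carrier}
    (hΞ : closure E.doc ⊆ Set.range Ξ) : Function.Surjective Ξ :=
  fun y ↦ hΞ (by rw [E.closure_doc_eq_univ h]; exact mem_univ y)

end TameEternalLimit

/-- Registered sub-goal `stub_closureDocEqDocUnionHorizon` of `stub_harmonicPresentation` (S3):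
the set `closure E.doc` that a presentation must cover is exactly `doc ∪ horizon`, and the horizon
is empty iff the d.o.c. is everything. [folklore] -/
theorem stub_closureDocEqDocUnionHorizon :
    ∀ E : TameEternalLimit, closure E.doc = E.doc ∪ E.horizon ∧ (E.horizon = ∅ ↔ E.doc = Set.univ) :=
  fun E ↦ ⟨E.closure_doc_eq_union, E.horizon_eq_empty_iff⟩

/-- Registered sub-goal `stub_presentationSurjectiveOfHorizonless` of `stub_harmonicPresentation`
(S3): a covering map of a horizonless limit is surjective. [folklore] -/
theorem stub_presentationSurjectiveOfHorizonless :
    ∀ (E : TameEternalLimit) (α : Type) (Ξ : α → E.Z.carrier), E.horizon = ∅ → closure E.doc ⊆ Set.range Ξ → Function.Surjective Ξ :=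
  fun E _ _ h hΞ ↦ E.surjective_of_horizon_eq_empty h hΞ

/-! ## §2 The presentation cylinder `{x : E4 | r₀ < r(a, x)}` -/

section Cylinder

/-- The presentation cylinder is open (the Kerr–Schild radius is continuous). [folklore] -/
theorem isOpen_setOf_lt_radius (a r₀ : ℝ) : IsOpen {x : E4 | r₀ < Kerr.radius a x} :=
  isOpen_lt continuous_const (Kerr.continuous_radius a)

/-- **Time-translation invariance** of the presentation cylinder: `x + s ∂₀ ∈ cyl ↔ x ∈ cyl`
(the oblate radius `r(a, ·)` does not see `x⁰`). [cite: arXiv07060622, (35)] -/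
theorem add_smul_basisVector_zero_mem_setOf_lt_radius_iff (a r₀ : ℝ) (x : E4) (s : ℝ) :
    x + s • E4.basisVector 0 ∈ {x : E4 | r₀ < Kerr.radius a x} ↔
      x ∈ {x : E4 | r₀ < Kerr.radius a x} := by
  simp only [mem_setOf_eq, Kerr.radius_add_time_smul_basisVector]

/-- The time translate of the presentation cylinder is itself. [cite: arXiv07060622, (35)] -/
theorem image_add_smul_basisVector_zero_setOf_lt_radius (a r₀ s : ℝ) :
    (fun x : E4 ↦ x + s • E4.basisVector 0) '' {x : E4 | r₀ < Kerr.radius a x} =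
      {x : E4 | r₀ < Kerr.radius a x} := by
  ext y
  constructor
  · rintro ⟨x, hx, rfl⟩
    exact (add_smul_basisVector_zero_mem_setOf_lt_radius_iff a r₀ x s).mpr hx
  · intro hy
    refine ⟨y + (-s) • E4.basisVector 0,
      (add_smul_basisVector_zero_mem_setOf_lt_radius_iff a r₀ y (-s)).mpr hy, ?_⟩
    show y + (-s) • E4.basisVector 0 + s • E4.basisVector 0 = y
    rw [neg_smul, neg_add_cancel_right]

/-- The presentation cylinders are antitone in the inner radius. [folklore] -/
theorem setOf_lt_radius_antitone (a : ℝ) {r₀ r₁ : ℝ} (h : r₀ ≤ r₁) :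
    {x : E4 | r₁ < Kerr.radius a x} ⊆ {x : E4 | r₀ < Kerr.radius a x} :=
  fun _ hx ↦ h.trans_lt hx

/-- For `0 ≤ r₀` the presentation cylinder is the Kerr–Schild chart domain `Kerr.region a r₀`
(`{max r₀ 0 < r}`). [cite: arXiv08110354, §5.1] -/
theorem setOf_lt_radius_eq_region (a : ℝ) {r₀ : ℝ} (h : 0 ≤ r₀) :
    {x : E4 | r₀ < Kerr.radius a x} = (Kerr.region a r₀ : Set E4) := by
  ext x
  change r₀ < Kerr.radius a x ↔ x ∈ Kerr.region a r₀
  rw [Kerr.mem_region, max_eq_left h]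

/-- The Kerr–Schild oblate radius vanishes at the origin (`ρ = z = 0`). [cite: arXiv07060622, (35)] -/
theorem kerr_radius_zero (a : ℝ) : Kerr.radius a (0 : E4) = 0 := by
  have h0 : E4.spatialNorm (0 : E4) = 0 := by simp [E4.spatialNorm]
  unfold Kerr.radius
  rw [h0]
  have h1 : ((0 : ℝ) ^ 2 - a ^ 2) ^ 2 + 4 * a ^ 2 * (0 : E4) 3 ^ 2 = (a ^ 2) ^ 2 := by
    simp only [PiLp.zero_apply]; ring
  rw [h1, Real.sqrt_sq (sq_nonneg a)]
  norm_num

/-- The presentation cylinder is ALL of `E4` iff `r₀ < 0` (`r(a, ·) ≥ 0` with equality at the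
origin): `r₀ < 0` is exactly the horizonless presentation domain. [folklore] -/
theorem setOf_lt_radius_eq_univ_iff (a r₀ : ℝ) :
    {x : E4 | r₀ < Kerr.radius a x} = univ ↔ r₀ < 0 := by
  constructor
  · intro h
    have h0 : (0 : E4) ∈ {x : E4 | r₀ < Kerr.radius a x} := by rw [h]; exact mem_univ _
    simpa [kerr_radius_zero] using h0
  · exact fun h ↦ Set.eq_univ_of_forall fun x ↦ h.trans_le (Kerr.radius_nonneg a x)

end Cylinder

/-- Registered sub-goal `stub_cylBasicAPI` of `stub_harmonicPresentation` (S3): the presentation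
cylinder `{r₀ < r(a,·)}` is time-translation invariant, open, antitone in `r₀`, equal to
`Kerr.region a r₀` for `0 ≤ r₀`, and equal to `E4` iff `r₀ < 0`. [folklore] -/
theorem stub_cylBasicAPI :
    (∀ (a r₀ s : ℝ) (x : E4), x + s • E4.basisVector 0 ∈ {x : E4 | r₀ < Kerr.radius a x} ↔ x ∈ {x : E4 | r₀ < Kerr.radius a x}) ∧ (∀ a r₀ : ℝ, IsOpen {x : E4 | r₀ < Kerr.radius a x}) ∧ (∀ a r₀ r₁ : ℝ, r₀ ≤ r₁ → {x : E4 | r₁ < Kerr.radius a x} ⊆ {x : E4 | r₀ < Kerr.radius a x}) ∧ (∀ a r₀ : ℝ, 0 ≤ r₀ → {x : E4 | r₀ < Kerr.radius a x} = (Kerr.region a r₀ : Set E4)) ∧ (∀ a r₀ : ℝ, {x : E4 | r₀ < Kerr.radius a x} = Set.univ ↔ r₀ < 0) :=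
  ⟨fun a r₀ s x ↦ add_smul_basisVector_zero_mem_setOf_lt_radius_iff a r₀ x s, isOpen_setOf_lt_radius,
    fun a _ _ h ↦ setOf_lt_radius_antitone a h, fun a _ h ↦ setOf_lt_radius_eq_region a h,
    setOf_lt_radius_eq_univ_iff⟩

/-! ## §3 The identity presentation of Minkowski space on `{r₀ < r(a,·)} = E4`, `r₀ < 0` -/

section MinkowskiPresentation

/-- Along the inclusion `ι : U → (ℝ⁴, η)` of an open set, the deviation from the ZERO reference
form `⟨U, 0, x⁰, r(a,·)⟩` — i.e. the pulled-back metric itself — is the constant `η`. [folklore] -/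
theorem deviation_zeroRef_subtypeVal_minkowski (U : Opens E4) (a : ℝ) (x : U) :
    Minkowski.spacetime.deviation ⟨U, 0, fun y ↦ y 0, Kerr.radius a⟩ Subtype.val x =
      Minkowski.bilin := by
  ext v w
  change Minkowski.bilin (mfderiv 𝓘(ℝ, E4) 𝓘(ℝ, E4) (Subtype.val : U → E4) x v)
      (mfderiv 𝓘(ℝ, E4) 𝓘(ℝ, E4) (Subtype.val : U → E4) x w) -
    (0 : E4 → E4 →L[ℝ] E4 →L[ℝ] ℝ) x.1 v w = Minkowski.bilin v w
  rw [OpensChart.mfderiv_subtypeVal_apply, OpensChart.mfderiv_subtypeVal_apply]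
  simp

/-- Hence its zero-extended deviation equals `η` at every point OF `U`. [folklore] -/
theorem deviationExtend_zeroRef_subtypeVal_minkowski_of_mem (U : Opens E4) (a : ℝ) {y : E4}
    (hy : y ∈ U) :
    Minkowski.spacetime.deviationExtend ⟨U, 0, fun y ↦ y 0, Kerr.radius a⟩ Subtype.val y =
      Minkowski.bilin := by
  have h := Minkowski.spacetime.deviationExtend_coe ⟨U, 0, fun y ↦ y 0, Kerr.radius a⟩
    Subtype.val ⟨y, hy⟩
  rwa [deviation_zeroRef_subtypeVal_minkowski] at h

/-- **The presented components of Minkowski space in the identity chart of the cylinder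
`{r₀ < r(a,·)}`, `r₀ < 0`, are the constant `η` on all of `E4`** (the cylinder is everything, so
the zero extension never fires). [folklore] -/
theorem deviationExtend_cyl_subtypeVal_minkowski (a : ℝ) {r₀ : ℝ} (h : r₀ < 0) :
    Minkowski.spacetime.deviationExtend
        ⟨⟨{x : E4 | r₀ < Kerr.radius a x}, isOpen_setOf_lt_radius a r₀⟩, 0, fun y ↦ y 0,
          Kerr.radius a⟩ Subtype.val = fun _ ↦ Minkowski.bilin := by
  funext y
  exact deviationExtend_zeroRef_subtypeVal_minkowski_of_mem _ a (h.trans_le (Kerr.radius_nonneg a y))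

/-- The identity chart of the cylinder `{r₀ < r(a,·)}`, `r₀ < 0`, covers every subset of
Minkowski spacetime (its range is everything). [folklore] -/
theorem subset_range_cyl_subtypeVal (a : ℝ) {r₀ : ℝ} (h : r₀ < 0)
    (S : Set Minkowski.spacetime.carrier) :
    S ⊆ Set.range (Subtype.val :
      (⟨{x : E4 | r₀ < Kerr.radius a x}, isOpen_setOf_lt_radius a r₀⟩ : Opens E4) →
        Minkowski.spacetime.carrier) := by
  intro y _
  exact ⟨⟨y, h.trans_le (Kerr.radius_nonneg a y)⟩, rfl⟩

/-- **The presented future normal of the identity presentation is `∂₀`, hence future-directed**: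
`ι_*(−♯_G dx⁰) = −♯_η dx⁰ = ∂₀`, the Minkowski time orientation. [folklore] -/
theorem isFutureDirected_identityPresentation (a : ℝ) {r₀ : ℝ} (h : r₀ < 0)
    (x : (⟨{x : E4 | r₀ < Kerr.radius a x}, isOpen_setOf_lt_radius a r₀⟩ : Opens E4)) :
    Minkowski.spacetime.timeOrientation.IsFutureDirected
      (mfderiv 𝓘(ℝ, E4) (𝓡 4)
        (Subtype.val : (⟨{x : E4 | r₀ < Kerr.radius a x}, isOpen_setOf_lt_radius a r₀⟩ :
          Opens E4) → Minkowski.spacetime.carrier) x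
        (-(MetricCoord.sharpAt (Minkowski.spacetime.deviationExtend
          ⟨⟨{x : E4 | r₀ < Kerr.radius a x}, isOpen_setOf_lt_radius a r₀⟩, 0, fun y ↦ y 0,
            Kerr.radius a⟩ Subtype.val) x.1 (E4.dx 0)))) := by
  rw [deviationExtend_cyl_subtypeVal_minkowski a h, CoordSphere.sharpAt_minkowski_dx_zero, neg_neg]
  have e : mfderiv 𝓘(ℝ, E4) (𝓡 4)
      (Subtype.val : (⟨{x : E4 | r₀ < Kerr.radius a x}, isOpen_setOf_lt_radius a r₀⟩ :
        Opens E4) → Minkowski.spacetime.carrier) x (E4.basisVector 0) = E4.basisVector 0 :=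
    OpensChart.mfderiv_subtypeVal_apply x _
  rw [e]
  exact Minkowski.spacetime.timeOrientation.isFutureDirected_vectorField (x : E4)

end MinkowskiPresentation

/-- Registered sub-goal `stub_minkowskiIdentityPresentation` of `stub_harmonicPresentation` (S3):
for `r₀ < 0` the identity chart of the cylinder `{r₀ < r(a,·)} = E4` into Minkowski spacetime is an
injective local diffeomorphism covering everything, future-oriented for its presented components,
which are the constant `η` — the four `G`-independent fields of `IsPresentedBy`; with the
neighbour lemma "flat space is a presented dark exterior for `r₀ < 0`" (stub S4's worker) this
presents the exact Minkowski limit. [folklore] -/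
theorem stub_minkowskiIdentityPresentation :
    ∀ (a r₀ : ℝ), r₀ < 0 → IsLocalDiffeomorph 𝓘(ℝ, E4) (𝓡 4) (⊤ : ℕ∞) (Subtype.val : (⟨{x : E4 | r₀ < Kerr.radius a x}, isOpen_lt continuous_const (Kerr.continuous_radius a)⟩ : Opens E4) → Minkowski.spacetime.carrier) ∧ Function.Injective (Subtype.val : (⟨{x : E4 | r₀ < Kerr.radius a x}, isOpen_lt continuous_const (Kerr.continuous_radius a)⟩ : Opens E4) → Minkowski.spacetime.carrier) ∧ (∀ S : Set Minkowski.spacetime.carrier, S ⊆ Set.range (Subtype.val : (⟨{x : E4 | r₀ < Kerr.radius a x}, isOpen_lt continuous_const (Kerr.continuous_radius a)⟩ : Opens E4) → Minkowski.spacetime.carrier)) ∧ (∀ x : (⟨{x : E4 | r₀ < Kerr.radius a x}, isOpen_lt continuous_const (Kerr.continuous_radius a)⟩ : Opens E4), Minkowski.spacetime.timeOrientation.IsFutureDirected (mfderiv 𝓘(ℝ, E4) (𝓡 4) (Subtype.val : (⟨{x : E4 | r₀ < Kerr.radius a x}, isOpen_lt continuous_const (Kerr.continuous_radius a)⟩ :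 Opens E4) → Minkowski.spacetime.carrier) x (-(MetricCoord.sharpAt (Minkowski.spacetime.deviationExtend ⟨⟨{x : E4 | r₀ < Kerr.radius a x}, isOpen_lt continuous_const (Kerr.continuous_radius a)⟩, 0, fun y ↦ y 0, Kerr.radius a⟩ Subtype.val) x.1 (E4.dx 0))))) ∧ Minkowski.spacetime.deviationExtend ⟨⟨{x : E4 | r₀ < Kerr.radius a x}, isOpen_lt continuous_const (Kerr.continuous_radius a)⟩, 0, fun y ↦ y 0, Kerr.radius a⟩ Subtype.val = fun _ ↦ Minkowski.bilin :=
  fun a _ h ↦ ⟨isLocalDiffeomorph_subtypeVal_minkowski _, Subtype.val_injective,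
    subset_range_cyl_subtypeVal a h, isFutureDirected_identityPresentation a h,
    deviationExtend_cyl_subtypeVal_minkowski a h⟩

/-! ## §4 What the fields `isLocalDiffeomorph / injective / covers` of `IsPresentedBy` force:
an open submanifold `≅ U` of `Z` containing `doc ∪ 𝓗`; for a HORIZONLESS limit `Z ≅ U`, and
`Z ≅ ℝ⁴` when the cylinder is everything (`r₀ < 0`) -/

namespace TameEternalLimit

variable (E : TameEternalLimit)

/-- An injective local diffeomorphism of an open `U ⊆ E4` into the limit (the first two fields of
`IsPresentedBy`) is an open embedding: its range is an open submanifold of `Z` diffeomorphic to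
`U`. [folklore] -/
theorem isOpenEmbedding_of_isLocalDiffeomorph {U : Opens E4} {Ξ : U → E.Z.carrier}
    (h₁ : IsLocalDiffeomorph 𝓘(ℝ, E4) (𝓡 4) (⊤ : ℕ∞) Ξ) (h₂ : Function.Injective Ξ) :
    Topology.IsOpenEmbedding Ξ :=
  h₁.isLocalHomeomorph.isOpenEmbedding_of_injective h₂

/-- The field `covers : closure doc ⊆ range Ξ` says: the d.o.c. AND the whole event horizon lie
in the range. [folklore] -/
theorem doc_union_horizon_subset_range {α : Type*} {Ξ : α → E.Z.carrier}
    (h : closure E.doc ⊆ Set.range Ξ) : E.doc ∪ E.horizon ⊆ Set.range Ξ := by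
  rwa [← E.closure_doc_eq_union]

/-- **A presented HORIZONLESS limit is diffeomorphic to its presentation domain** (bijective
local diffeomorphism). [folklore] -/
theorem nonempty_diffeomorph_of_horizon_eq_empty (h : E.horizon = ∅) {U : Opens E4}
    {Ξ : U → E.Z.carrier} (h₁ : IsLocalDiffeomorph 𝓘(ℝ, E4) (𝓡 4) (⊤ : ℕ∞) Ξ)
    (h₂ : Function.Injective Ξ) (h₃ : closure E.doc ⊆ Set.range Ξ) :
    Nonempty (Diffeomorph 𝓘(ℝ, E4) (𝓡 4) U E.Z.carrier ((⊤ : ℕ∞) : WithTop ℕ∞)) :=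
  ⟨h₁.diffeomorphOfBijective ⟨h₂, E.surjective_of_horizon_eq_empty h h₃⟩⟩

end TameEternalLimit

/-- The identity chart of an open `U ⊆ E4` which is all of `E4` (the cylinder `{r₀ < r(a,·)}`
with `r₀ < 0`, §2) is a diffeomorphism onto `ℝ⁴`. [folklore] -/
theorem nonempty_diffeomorph_subtypeVal_of_coe_eq_univ {U : Opens E4} (hU : (U : Set E4) = univ) :
    Nonempty (Diffeomorph 𝓘(ℝ, E4) (𝓡 4) U E4 ((⊤ : ℕ∞) : WithTop ℕ∞)) :=
  ⟨(isLocalDiffeomorph_subtypeVal_minkowski U).diffeomorphOfBijective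
    ⟨Subtype.val_injective, fun y ↦ ⟨⟨y, by rw [← SetLike.mem_coe, hU]; exact mem_univ y⟩, rfl⟩⟩⟩

/-- Registered sub-goal `stub_horizonlessPresentedIsR4` of `stub_harmonicPresentation` (S3): **the
topological content of S3 on horizonless limits** — if a `TameEternalLimit` with EMPTY horizon is
presented on the cylinder `{r₀ < r(a,·)}` with `r₀ < 0` (fields `isLocalDiffeomorph`, `injective`,
`covers` of `IsPresentedBy`), then `Z` is diffeomorphic to `ℝ⁴`.  So S3 asserts in particular
that every horizonless tame eternal limit presented with `r₀ < 0` has `Z ≅ ℝ⁴` (cut (d) of its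
docstring is not a side remark but part of the claim). [folklore] -/
theorem stub_horizonlessPresentedIsR4 :
    ∀ (E : TameEternalLimit) (a r₀ : ℝ), r₀ < 0 → E.horizon = ∅ → ∀ Ξ : (⟨{x : E4 | r₀ < Kerr.radius a x}, isOpen_lt continuous_const (Kerr.continuous_radius a)⟩ : Opens E4) → E.Z.carrier, IsLocalDiffeomorph 𝓘(ℝ, E4) (𝓡 4) (⊤ : ℕ∞) Ξ → Function.Injective Ξ → closure E.doc ⊆ Set.range Ξ → Nonempty (Diffeomorph (𝓡 4) (𝓡 4) E.Z.carrier E4 ((⊤ : ℕ∞) : WithTop ℕ∞)) := by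
  intro E a r₀ hr h Ξ h₁ h₂ h₃
  obtain ⟨D₁⟩ := E.nonempty_diffeomorph_of_horizon_eq_empty h h₁ h₂ h₃
  obtain ⟨D₂⟩ := nonempty_diffeomorph_subtypeVal_of_coe_eq_univ
    (U := ⟨{x : E4 | r₀ < Kerr.radius a x}, isOpen_lt continuous_const (Kerr.continuous_radius a)⟩)
    ((setOf_lt_radius_eq_univ_iff a r₀).mpr hr)
  exact ⟨D₁.symm.trans D₂⟩

end Summit.FinalStateConjecture.FinalStateConjecture.Theorems.TrappedSet

end
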